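import Summits.QuantumFields.YangMills.Theorems.UnitScaleTiltProp7CombLadderCountExactWeights
import HarnessLib

/-!
# Route `UnitScaleTilt`, crux K1 «MinimiserStabilityRegPr» (stmt-QuantumFields-19200), route-R E′ path (α′), S3 K-form engine, row (H) — FILE 9h‴ «OFFSET-AVERAGED EXACT WEIGHTS»:
# the exact multiplicities of ✓ `Prop7CombLadderCountExact` SUMMED OVER THE OFFSETS `h < H` of the base along a direction `ι`, in ABSOLUTE position: for a FREE coordinate `ι` of the
# run (`ι ∉ D ∪ {κ}`) the trunk plane `{q′ ι = 0}` meets each line `h ↦ q − h•e_ι` at most ONCE, so `Σ_(h<H) W^±_(D,κ)(q − h•e_ι) ≤ C·(R ∓ q κ)⁺·(2R+1)^(d−(|D|+1))` carries NO factor `H`;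
# for a determined coordinate (or `ι = κ`) the trivial bound carries the factor `H` but no trunk plane — the multiplicity half of ★p1 g16's «(H)-RED-1: hDir ⟸ hKg-K» (WORD 7 (3),
# «count with TRUE ∕ h-AVERAGED multiplicities … 4R²»)

Cell `ym3-torus`, width seat `ym3-torus-px9` (gen 4); offered 2026-08-28 23:50Z as «px9: F-H9h‴ OFFSET-AVERAGED WEIGHTS» under ★p1 g16 NAMER WORD 4 (1) ∕ WORD 7 (px9 holds the count,
routeR-w1 the ladders ∕ `_pt` chain).  THEOREMS ONLY (0 `def`, 0 `sorry`); `--supports stmt-QuantumFields-19200 --as helper`, count-neutral.  YM₃ on T³ is a RUNG of the ladder (R3) — not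
d = 4, not infinite volume, not a mass gap, not the Clay problem; nothing here claims a stub, the crux or any summit statement.

WHAT IS PROVED (ns `…Theorems.Prop7CombLadderCountExactOffsets`; letters of ✓ `Prop7CombLadderCountExact(Weights)` verbatim — box `Fintype.piFinset (fun _ => Icc (−R) R)`, inline fibre
predicates `P^±_(D,κ)(v,q)`, weights `W^±_(D,κ)(q) = Σ_(v ∈ box, P^±(v,q)) c v`).
* §1 ★ `weight_pos_le' ∕ weight_neg_le'` — ✓ `weight_pos_le ∕ weight_neg_le` WITHOUT the hypothesis `q ∈ box` (a non-empty fibre forces `q` into the box): for `c ≤ C` on the box, `0 ≤ C`,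
  `W^±_(D,κ)(q) ≤ C·(R ∓ q κ)⁺·(2R+1)^(d−(|D|+1))` at EVERY `q : ℤ^d`.
* §2 `filter_pos_shift_eq_empty ∕ filter_neg_shift_eq_empty` (`ι ∉ D`, `ι ≠ κ`, `q ι ≠ h` ⇒ the fibre of `q − h•e_ι` is empty), ★★ `sum_offsets_weight_pos_le ∕ sum_offsets_weight_neg_le`
  (FREE coordinate: `Σ_(h<H) W^±(q − h•e_ι) ≤ C·(R ∓ q κ)⁺·(2R+1)^(d−(|D|+1))`, NO factor `H`), ★ `weight_pos∕neg_le_unif` (`W^± ≤ C·R·(2R+1)^(d−(|D|+1))` at every `q`),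
  `sum_offsets_weight_pos_le_mul ∕ _neg_` (ANY `ι`, also `ι = κ` — the last run: `Σ_(h<H) W^± ≤ H·C·R·(2R+1)^(d−(|D|+1))`, i.e. `h`-average `≤ C·R·(…)` uniformly in `q`).
* §3 THE COMB READING: for the split `(finRange d).reverse = s ++ μ :: t`, run `i`, `ι ∈ t.drop (i+1)` (a LATER comb direction — e.g. `ι = 0`, the last one, for every run but the last):
  ★★ `sum_offsets_combWeight_pos_le ∕ _neg_le` — `Σ_(h<H) W^±_(D_i,t[i])(q − h•e_ι) ≤ C·(R ∓ q (t[i]))⁺·(2R+1)^(|t|−1−i)` (✓ `not_mem_foldl_insert_iff`, ✓ `card_foldl_insert`).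
HONEST SCOPE.  Finite combinatorics on `ℤ^d`; the identification of the consumer's offset bases with `q − h•e_ι` in pulled-back coordinates (✓ `Prop7AxialOffsetFamily`) and every booking
(the «4R²»-class constant at `R = 4ℓ`, `H = ℓ′`) are the consumer's arithmetic over these rows.

References: T. Bałaban, CMP 98 (1985) 17–51 [Balaban1985Averaging] ((8)–(9) pp.18–19, (19)–(20) p.21, p.24); CMP 102 (1985) 255–275 [Balaban1985UV3] ((27) p.263).
-/

set_option autoImplicit false

open scoped BigOperators

namespace Summit.QuantumFields.YangMills.Theorems.Prop7CombLadderCountExactOffsets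

open Literature.MathematicalPhysics.QuantumFieldTheory.Balaban1983to89
open B7Prop1Explicit (Site Letter e e_apply seg)
open Summit.QuantumFields.YangMills.Theorems.Prop7CombLadderCount (mem_box_iff split_nodup)
open Summit.QuantumFields.YangMills.Theorems.Prop7CombLadderCountExact (mem_foldl_insert card_foldl_insert)
open Summit.QuantumFields.YangMills.Theorems.Prop7CombLadderCountExactWeights (filter_pos_eq_empty filter_neg_eq_empty weight_pos_le weight_neg_le not_mem_foldl_insert_iff)

variable {d : ℕ}

/-! ## §1 The weight bounds at every `q : ℤ^d` -/

/-- a non-empty forward fibre forces `q` into the box. [folklore] -/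
theorem mem_box_of_filter_pos_nonempty (R : ℕ) (D : Finset (Fin d)) (κ : Fin d) (q : Site d)
    (h : ((Fintype.piFinset (fun _ : Fin d => Finset.Icc (-(R : ℤ)) (R : ℤ))).filter
        (fun v => (∀ ν ∈ D, q ν = v ν) ∧ (∀ ν, ν ∉ D → ν ≠ κ → q ν = 0) ∧ 0 ≤ q κ ∧ q κ < v κ)).Nonempty) :
    q ∈ Fintype.piFinset (fun _ : Fin d => Finset.Icc (-(R : ℤ)) (R : ℤ)) := by
  obtain ⟨v, hv⟩ := h
  obtain ⟨hvb, hagree, htrunk, hsgn, hlt⟩ := Finset.mem_filter.mp hv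
  have hvb' := (mem_box_iff (R := R)).mp hvb
  refine (mem_box_iff (R := R)).mpr fun ν => ?_
  by_cases hνD : ν ∈ D
  · rw [hagree ν hνD]; exact hvb' ν
  · by_cases hνκ : ν = κ
    · rw [hνκ]; have := hvb' κ; constructor <;> omega
    · rw [htrunk ν hνD hνκ]; constructor <;> omega

/-- a non-empty backward fibre forces `q` into the box. [folklore] -/
theorem mem_box_of_filter_neg_nonempty (R : ℕ) (D : Finset (Fin d)) (κ : Fin d) (q : Site d)
    (h : ((Fintype.piFinset (fun _ : Fin d => Finset.Icc (-(R : ℤ)) (R : ℤ))).filter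
        (fun v => (∀ ν ∈ D, q ν = v ν) ∧ (∀ ν, ν ∉ D → ν ≠ κ → q ν = 0) ∧ v κ < q κ ∧ q κ ≤ 0)).Nonempty) :
    q ∈ Fintype.piFinset (fun _ : Fin d => Finset.Icc (-(R : ℤ)) (R : ℤ)) := by
  obtain ⟨v, hv⟩ := h
  obtain ⟨hvb, hagree, htrunk, hlt, hsgn⟩ := Finset.mem_filter.mp hv
  have hvb' := (mem_box_iff (R := R)).mp hvb
  refine (mem_box_iff (R := R)).mpr fun ν => ?_
  by_cases hνD : ν ∈ D
  · rw [hagree ν hνD]; exact hvb' ν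
  · by_cases hνκ : ν = κ
    · rw [hνκ]; have := hvb' κ; constructor <;> omega
    · rw [htrunk ν hνD hνκ]; constructor <;> omega

/-- ★ WEIGHT BOUND (forward) AT EVERY `q : ℤ^d` (no `q ∈ box` hypothesis): `W⁺_(D,κ)(q) ≤ C·(R − q κ)⁺·(2R+1)^(d−(|D|+1))` for `c ≤ C` on the box, `0 ≤ C`.
[cite: Balaban1985Averaging, (8)–(9) pp.18–19, p.24] -/
theorem weight_pos_le' (R : ℕ) (D : Finset (Fin d)) (κ : Fin d) (hκ : κ ∉ D) (c : Site d → ℝ) (C : ℝ) (hC : 0 ≤ C)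
    (hc : ∀ v ∈ Fintype.piFinset (fun _ : Fin d => Finset.Icc (-(R : ℤ)) (R : ℤ)), c v ≤ C) (q : Site d) :
    ∑ v ∈ (Fintype.piFinset (fun _ : Fin d => Finset.Icc (-(R : ℤ)) (R : ℤ))).filter
        (fun v => (∀ ν ∈ D, q ν = v ν) ∧ (∀ ν, ν ∉ D → ν ≠ κ → q ν = 0) ∧ 0 ≤ q κ ∧ q κ < v κ), c v
      ≤ C * ((((R : ℤ) - q κ).toNat * (2 * R + 1) ^ (d - (D.card + 1)) : ℕ) : ℝ) := by
  by_cases h : ((Fintype.piFinset (fun _ : Fin d => Finset.Icc (-(R : ℤ)) (R : ℤ))).filter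
      (fun v => (∀ ν ∈ D, q ν = v ν) ∧ (∀ ν, ν ∉ D → ν ≠ κ → q ν = 0) ∧ 0 ≤ q κ ∧ q κ < v κ)).Nonempty
  · exact weight_pos_le R D κ hκ c C hC hc q (mem_box_of_filter_pos_nonempty R D κ q h)
  · rw [Finset.not_nonempty_iff_eq_empty.mp h, Finset.sum_empty]; positivity

/-- ★ WEIGHT BOUND (backward) AT EVERY `q : ℤ^d`: `W⁻_(D,κ)(q) ≤ C·(R + q κ)⁺·(2R+1)^(d−(|D|+1))`. [cite: Balaban1985Averaging, (8)–(9) pp.18–19, p.24] -/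
theorem weight_neg_le' (R : ℕ) (D : Finset (Fin d)) (κ : Fin d) (hκ : κ ∉ D) (c : Site d → ℝ) (C : ℝ) (hC : 0 ≤ C)
    (hc : ∀ v ∈ Fintype.piFinset (fun _ : Fin d => Finset.Icc (-(R : ℤ)) (R : ℤ)), c v ≤ C) (q : Site d) :
    ∑ v ∈ (Fintype.piFinset (fun _ : Fin d => Finset.Icc (-(R : ℤ)) (R : ℤ))).filter
        (fun v => (∀ ν ∈ D, q ν = v ν) ∧ (∀ ν, ν ∉ D → ν ≠ κ → q ν = 0) ∧ v κ < q κ ∧ q κ ≤ 0), c v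
      ≤ C * ((((R : ℤ) + q κ).toNat * (2 * R + 1) ^ (d - (D.card + 1)) : ℕ) : ℝ) := by
  by_cases h : ((Fintype.piFinset (fun _ : Fin d => Finset.Icc (-(R : ℤ)) (R : ℤ))).filter
      (fun v => (∀ ν ∈ D, q ν = v ν) ∧ (∀ ν, ν ∉ D → ν ≠ κ → q ν = 0) ∧ v κ < q κ ∧ q κ ≤ 0)).Nonempty
  · exact weight_neg_le R D κ hκ c C hC hc q (mem_box_of_filter_neg_nonempty R D κ q h)
  · rw [Finset.not_nonempty_iff_eq_empty.mp h, Finset.sum_empty]; positivity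

/-! ## §2 Summing the weights over the offsets `q − h•e_ι` -/

/-- coordinates of the shifted point: `(q − h•e_ι) ν = q ν − (if ν = ι then h else 0)`. [folklore] -/
theorem shift_apply (q : Site d) (ι : Fin d) (h : ℤ) (ν : Fin d) : (q - h • e ι) ν = q ν - if ν = ι then h else 0 := by
  rw [Pi.sub_apply, Pi.smul_apply, e_apply, smul_eq_mul, mul_ite, mul_one, mul_zero]

/-- FREE COORDINATE, WRONG OFFSET ⇒ EMPTY (forward): for `ι ∉ D`, `ι ≠ κ` and `q ι ≠ h` the forward fibre of `q − h•e_ι` is empty (its trunk condition at `ι` reads `q ι − h = 0`).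
[cite: Balaban1985Averaging, p.24] -/
theorem filter_pos_shift_eq_empty (R : ℕ) (D : Finset (Fin d)) (κ ι : Fin d) (hι : ι ∉ D) (hικ : ι ≠ κ) (q : Site d) (h : ℤ) (hne : q ι ≠ h) :
    (Fintype.piFinset (fun _ : Fin d => Finset.Icc (-(R : ℤ)) (R : ℤ))).filter
        (fun v => (∀ ν ∈ D, (q - h • e ι) ν = v ν) ∧ (∀ ν, ν ∉ D → ν ≠ κ → (q - h • e ι) ν = 0) ∧ 0 ≤ (q - h • e ι) κ ∧ (q - h • e ι) κ < v κ) = ∅ :=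
  filter_pos_eq_empty R D κ (q - h • e ι) fun hh => hne (by have := hh.1 ι hι hικ; rw [shift_apply, if_pos rfl] at this; omega)

/-- FREE COORDINATE, WRONG OFFSET ⇒ EMPTY (backward). [cite: Balaban1985Averaging, p.24] -/
theorem filter_neg_shift_eq_empty (R : ℕ) (D : Finset (Fin d)) (κ ι : Fin d) (hι : ι ∉ D) (hικ : ι ≠ κ) (q : Site d) (h : ℤ) (hne : q ι ≠ h) :
    (Fintype.piFinset (fun _ : Fin d => Finset.Icc (-(R : ℤ)) (R : ℤ))).filter
        (fun v => (∀ ν ∈ D, (q - h • e ι) ν = v ν) ∧ (∀ ν, ν ∉ D → ν ≠ κ → (q - h • e ι) ν = 0) ∧ v κ < (q - h • e ι) κ ∧ (q - h • e ι) κ ≤ 0) = ∅ :=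
  filter_neg_eq_empty R D κ (q - h • e ι) fun hh => hne (by have := hh.1 ι hι hικ; rw [shift_apply, if_pos rfl] at this; omega)

/-- ★★ **OFFSET SUM OVER A FREE COORDINATE — NO FACTOR `H` (forward)**: for `ι ∉ D`, `ι ≠ κ`, `c ≤ C` on the box, `0 ≤ C`,
`Σ_(h<H) W⁺_(D,κ)(q − h•e_ι) ≤ C·(R − q κ)⁺·(2R+1)^(d−(|D|+1))` — only the offset `h = q ι` can meet the trunk plane. [cite: Balaban1985Averaging, (8)–(9) pp.18–19, p.24] -/
theorem sum_offsets_weight_pos_le (R H : ℕ) (D : Finset (Fin d)) (κ ι : Fin d) (hκ : κ ∉ D) (hι : ι ∉ D) (hικ : ι ≠ κ) (c : Site d → ℝ) (C : ℝ) (hC : 0 ≤ C)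
    (hc : ∀ v ∈ Fintype.piFinset (fun _ : Fin d => Finset.Icc (-(R : ℤ)) (R : ℤ)), c v ≤ C) (q : Site d) :
    ∑ h ∈ Finset.range H, ∑ v ∈ (Fintype.piFinset (fun _ : Fin d => Finset.Icc (-(R : ℤ)) (R : ℤ))).filter
        (fun v => (∀ ν ∈ D, (q - (h : ℤ) • e ι) ν = v ν) ∧ (∀ ν, ν ∉ D → ν ≠ κ → (q - (h : ℤ) • e ι) ν = 0)
          ∧ 0 ≤ (q - (h : ℤ) • e ι) κ ∧ (q - (h : ℤ) • e ι) κ < v κ), c v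
      ≤ C * ((((R : ℤ) - q κ).toNat * (2 * R + 1) ^ (d - (D.card + 1)) : ℕ) : ℝ) := by
  have hκc : ∀ h : ℤ, (q - h • e ι) κ = q κ := fun h => by rw [shift_apply, if_neg (Ne.symm hικ), sub_zero]
  have hterm : ∀ h ∈ Finset.range H, ∑ v ∈ (Fintype.piFinset (fun _ : Fin d => Finset.Icc (-(R : ℤ)) (R : ℤ))).filter
        (fun v => (∀ ν ∈ D, (q - (h : ℤ) • e ι) ν = v ν) ∧ (∀ ν, ν ∉ D → ν ≠ κ → (q - (h : ℤ) • e ι) ν = 0)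
          ∧ 0 ≤ (q - (h : ℤ) • e ι) κ ∧ (q - (h : ℤ) • e ι) κ < v κ), c v
      = if ((h : ℤ) = q ι) then ∑ v ∈ (Fintype.piFinset (fun _ : Fin d => Finset.Icc (-(R : ℤ)) (R : ℤ))).filter
        (fun v => (∀ ν ∈ D, (q - (h : ℤ) • e ι) ν = v ν) ∧ (∀ ν, ν ∉ D → ν ≠ κ → (q - (h : ℤ) • e ι) ν = 0)
          ∧ 0 ≤ (q - (h : ℤ) • e ι) κ ∧ (q - (h : ℤ) • e ι) κ < v κ), c v else 0 := by
    intro h _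
    split_ifs with hh
    · rfl
    · rw [filter_pos_shift_eq_empty R D κ ι hι hικ q h (Ne.symm hh), Finset.sum_empty]
  rw [Finset.sum_congr rfl hterm, Finset.sum_ite, Finset.sum_const_zero, add_zero]
  have hcard : ((Finset.range H).filter (fun h : ℕ => (h : ℤ) = q ι)).card ≤ 1 := by
    refine Finset.card_le_one.mpr fun a ha b hb => ?_
    have h1 := (Finset.mem_filter.mp ha).2; have h2 := (Finset.mem_filter.mp hb).2; omega
  have hbd : ∀ h ∈ (Finset.range H).filter (fun h : ℕ => (h : ℤ) = q ι), ∑ v ∈ (Fintype.piFinset (fun _ : Fin d => Finset.Icc (-(R : ℤ)) (R : ℤ))).filter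
        (fun v => (∀ ν ∈ D, (q - (h : ℤ) • e ι) ν = v ν) ∧ (∀ ν, ν ∉ D → ν ≠ κ → (q - (h : ℤ) • e ι) ν = 0)
          ∧ 0 ≤ (q - (h : ℤ) • e ι) κ ∧ (q - (h : ℤ) • e ι) κ < v κ), c v
      ≤ C * ((((R : ℤ) - q κ).toNat * (2 * R + 1) ^ (d - (D.card + 1)) : ℕ) : ℝ) := by
    intro h _
    rw [← hκc (h : ℤ)]
    exact weight_pos_le' R D κ hκ c C hC hc (q - (h : ℤ) • e ι)
  have hnn : 0 ≤ C * ((((R : ℤ) - q κ).toNat * (2 * R + 1) ^ (d - (D.card + 1)) : ℕ) : ℝ) := by positivity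
  calc _ ≤ ∑ h ∈ (Finset.range H).filter (fun h : ℕ => (h : ℤ) = q ι), C * ((((R : ℤ) - q κ).toNat * (2 * R + 1) ^ (d - (D.card + 1)) : ℕ) : ℝ) :=
        Finset.sum_le_sum hbd
    _ = (((Finset.range H).filter (fun h : ℕ => (h : ℤ) = q ι)).card : ℝ) * _ := by rw [Finset.sum_const, nsmul_eq_mul]
    _ ≤ 1 * _ := mul_le_mul_of_nonneg_right (by exact_mod_cast hcard) hnn
    _ = _ := one_mul _

/-- ★★ **OFFSET SUM OVER A FREE COORDINATE — NO FACTOR `H` (backward)**: `Σ_(h<H) W⁻_(D,κ)(q − h•e_ι) ≤ C·(R + q κ)⁺·(2R+1)^(d−(|D|+1))`. [cite: Balaban1985Averaging, (8)–(9) pp.18–19, p.24] -/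
theorem sum_offsets_weight_neg_le (R H : ℕ) (D : Finset (Fin d)) (κ ι : Fin d) (hκ : κ ∉ D) (hι : ι ∉ D) (hικ : ι ≠ κ) (c : Site d → ℝ) (C : ℝ) (hC : 0 ≤ C)
    (hc : ∀ v ∈ Fintype.piFinset (fun _ : Fin d => Finset.Icc (-(R : ℤ)) (R : ℤ)), c v ≤ C) (q : Site d) :
    ∑ h ∈ Finset.range H, ∑ v ∈ (Fintype.piFinset (fun _ : Fin d => Finset.Icc (-(R : ℤ)) (R : ℤ))).filter
        (fun v => (∀ ν ∈ D, (q - (h : ℤ) • e ι) ν = v ν) ∧ (∀ ν, ν ∉ D → ν ≠ κ → (q - (h : ℤ) • e ι) ν = 0)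
          ∧ v κ < (q - (h : ℤ) • e ι) κ ∧ (q - (h : ℤ) • e ι) κ ≤ 0), c v
      ≤ C * ((((R : ℤ) + q κ).toNat * (2 * R + 1) ^ (d - (D.card + 1)) : ℕ) : ℝ) := by
  have hκc : ∀ h : ℤ, (q - h • e ι) κ = q κ := fun h => by rw [shift_apply, if_neg (Ne.symm hικ), sub_zero]
  have hterm : ∀ h ∈ Finset.range H, ∑ v ∈ (Fintype.piFinset (fun _ : Fin d => Finset.Icc (-(R : ℤ)) (R : ℤ))).filter
        (fun v => (∀ ν ∈ D, (q - (h : ℤ) • e ι) ν = v ν) ∧ (∀ ν, ν ∉ D → ν ≠ κ → (q - (h : ℤ) • e ι) ν = 0)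
          ∧ v κ < (q - (h : ℤ) • e ι) κ ∧ (q - (h : ℤ) • e ι) κ ≤ 0), c v
      = if ((h : ℤ) = q ι) then ∑ v ∈ (Fintype.piFinset (fun _ : Fin d => Finset.Icc (-(R : ℤ)) (R : ℤ))).filter
        (fun v => (∀ ν ∈ D, (q - (h : ℤ) • e ι) ν = v ν) ∧ (∀ ν, ν ∉ D → ν ≠ κ → (q - (h : ℤ) • e ι) ν = 0)
          ∧ v κ < (q - (h : ℤ) • e ι) κ ∧ (q - (h : ℤ) • e ι) κ ≤ 0), c v else 0 := by
    intro h _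
    split_ifs with hh
    · rfl
    · rw [filter_neg_shift_eq_empty R D κ ι hι hικ q h (Ne.symm hh), Finset.sum_empty]
  rw [Finset.sum_congr rfl hterm, Finset.sum_ite, Finset.sum_const_zero, add_zero]
  have hcard : ((Finset.range H).filter (fun h : ℕ => (h : ℤ) = q ι)).card ≤ 1 := by
    refine Finset.card_le_one.mpr fun a ha b hb => ?_
    have h1 := (Finset.mem_filter.mp ha).2; have h2 := (Finset.mem_filter.mp hb).2; omega
  have hbd : ∀ h ∈ (Finset.range H).filter (fun h : ℕ => (h : ℤ) = q ι), ∑ v ∈ (Fintype.piFinset (fun _ : Fin d => Finset.Icc (-(R : ℤ)) (R : ℤ))).filter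
        (fun v => (∀ ν ∈ D, (q - (h : ℤ) • e ι) ν = v ν) ∧ (∀ ν, ν ∉ D → ν ≠ κ → (q - (h : ℤ) • e ι) ν = 0)
          ∧ v κ < (q - (h : ℤ) • e ι) κ ∧ (q - (h : ℤ) • e ι) κ ≤ 0), c v
      ≤ C * ((((R : ℤ) + q κ).toNat * (2 * R + 1) ^ (d - (D.card + 1)) : ℕ) : ℝ) := by
    intro h _
    rw [← hκc (h : ℤ)]
    exact weight_neg_le' R D κ hκ c C hC hc (q - (h : ℤ) • e ι)
  have hnn : 0 ≤ C * ((((R : ℤ) + q κ).toNat * (2 * R + 1) ^ (d - (D.card + 1)) : ℕ) : ℝ) := by positivity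
  calc _ ≤ ∑ h ∈ (Finset.range H).filter (fun h : ℕ => (h : ℤ) = q ι), C * ((((R : ℤ) + q κ).toNat * (2 * R + 1) ^ (d - (D.card + 1)) : ℕ) : ℝ) :=
        Finset.sum_le_sum hbd
    _ = (((Finset.range H).filter (fun h : ℕ => (h : ℤ) = q ι)).card : ℝ) * _ := by rw [Finset.sum_const, nsmul_eq_mul]
    _ ≤ 1 * _ := mul_le_mul_of_nonneg_right (by exact_mod_cast hcard) hnn
    _ = _ := one_mul _

/-- ★ UNIFORM WEIGHT BOUND (forward): `W⁺_(D,κ)(q) ≤ C·R·(2R+1)^(d−(|D|+1))` at EVERY `q : ℤ^d` (on the support `0 ≤ q κ` so `(R − q κ)⁺ ≤ R`; off it the fibre is empty).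
[cite: Balaban1985Averaging, (8)–(9) pp.18–19, p.24] -/
theorem weight_pos_le_unif (R : ℕ) (D : Finset (Fin d)) (κ : Fin d) (hκ : κ ∉ D) (c : Site d → ℝ) (C : ℝ) (hC : 0 ≤ C)
    (hc : ∀ v ∈ Fintype.piFinset (fun _ : Fin d => Finset.Icc (-(R : ℤ)) (R : ℤ)), c v ≤ C) (q : Site d) :
    ∑ v ∈ (Fintype.piFinset (fun _ : Fin d => Finset.Icc (-(R : ℤ)) (R : ℤ))).filter
        (fun v => (∀ ν ∈ D, q ν = v ν) ∧ (∀ ν, ν ∉ D → ν ≠ κ → q ν = 0) ∧ 0 ≤ q κ ∧ q κ < v κ), c v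
      ≤ C * ((R * (2 * R + 1) ^ (d - (D.card + 1)) : ℕ) : ℝ) := by
  by_cases hq : 0 ≤ q κ
  · refine (weight_pos_le' R D κ hκ c C hC hc q).trans (mul_le_mul_of_nonneg_left ?_ hC)
    have : ((R : ℤ) - q κ).toNat ≤ R := by omega
    exact_mod_cast Nat.mul_le_mul_right _ this
  · rw [filter_pos_eq_empty R D κ q (fun hh => hq hh.2), Finset.sum_empty]; positivity

/-- ★ UNIFORM WEIGHT BOUND (backward): `W⁻_(D,κ)(q) ≤ C·R·(2R+1)^(d−(|D|+1))` at EVERY `q : ℤ^d`. [cite: Balaban1985Averaging, (8)–(9) pp.18–19, p.24] -/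
theorem weight_neg_le_unif (R : ℕ) (D : Finset (Fin d)) (κ : Fin d) (hκ : κ ∉ D) (c : Site d → ℝ) (C : ℝ) (hC : 0 ≤ C)
    (hc : ∀ v ∈ Fintype.piFinset (fun _ : Fin d => Finset.Icc (-(R : ℤ)) (R : ℤ)), c v ≤ C) (q : Site d) :
    ∑ v ∈ (Fintype.piFinset (fun _ : Fin d => Finset.Icc (-(R : ℤ)) (R : ℤ))).filter
        (fun v => (∀ ν ∈ D, q ν = v ν) ∧ (∀ ν, ν ∉ D → ν ≠ κ → q ν = 0) ∧ v κ < q κ ∧ q κ ≤ 0), c v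
      ≤ C * ((R * (2 * R + 1) ^ (d - (D.card + 1)) : ℕ) : ℝ) := by
  by_cases hq : q κ ≤ 0
  · refine (weight_neg_le' R D κ hκ c C hC hc q).trans (mul_le_mul_of_nonneg_left ?_ hC)
    have : ((R : ℤ) + q κ).toNat ≤ R := by omega
    exact_mod_cast Nat.mul_le_mul_right _ this
  · rw [filter_neg_eq_empty R D κ q (fun hh => hq hh.2), Finset.sum_empty]; positivity

/-- OFFSET SUM, ANY direction `ι` (determined coordinates and `ι = κ` included) — the trivial bound WITH the factor `H` (forward): `Σ_(h<H) W⁺_(D,κ)(q − h•e_ι) ≤ H·C·R·(2R+1)^(d−(|D|+1))`;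
its `h`-AVERAGE is the uniform profile `C·R·(2R+1)^(d−(|D|+1))` (for the LAST run of a comb, `(2R+1)^0 = 1`). [cite: Balaban1985Averaging, p.24] -/
theorem sum_offsets_weight_pos_le_mul (R H : ℕ) (D : Finset (Fin d)) (κ ι : Fin d) (hκ : κ ∉ D) (c : Site d → ℝ) (C : ℝ) (hC : 0 ≤ C)
    (hc : ∀ v ∈ Fintype.piFinset (fun _ : Fin d => Finset.Icc (-(R : ℤ)) (R : ℤ)), c v ≤ C) (q : Site d) :
    ∑ h ∈ Finset.range H, ∑ v ∈ (Fintype.piFinset (fun _ : Fin d => Finset.Icc (-(R : ℤ)) (R : ℤ))).filter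
        (fun v => (∀ ν ∈ D, (q - (h : ℤ) • e ι) ν = v ν) ∧ (∀ ν, ν ∉ D → ν ≠ κ → (q - (h : ℤ) • e ι) ν = 0)
          ∧ 0 ≤ (q - (h : ℤ) • e ι) κ ∧ (q - (h : ℤ) • e ι) κ < v κ), c v
      ≤ (H : ℝ) * (C * ((R * (2 * R + 1) ^ (d - (D.card + 1)) : ℕ) : ℝ)) := by
  calc _ ≤ ∑ h ∈ Finset.range H, C * ((R * (2 * R + 1) ^ (d - (D.card + 1)) : ℕ) : ℝ) :=
        Finset.sum_le_sum fun h _ => weight_pos_le_unif R D κ hκ c C hC hc (q - (h : ℤ) • e ι)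
    _ = _ := by rw [Finset.sum_const, Finset.card_range, nsmul_eq_mul]

/-- OFFSET SUM, ANY direction `ι` — the trivial bound WITH the factor `H` (backward): `Σ_(h<H) W⁻_(D,κ)(q − h•e_ι) ≤ H·C·R·(2R+1)^(d−(|D|+1))`. [cite: Balaban1985Averaging, p.24] -/
theorem sum_offsets_weight_neg_le_mul (R H : ℕ) (D : Finset (Fin d)) (κ ι : Fin d) (hκ : κ ∉ D) (c : Site d → ℝ) (C : ℝ) (hC : 0 ≤ C)
    (hc : ∀ v ∈ Fintype.piFinset (fun _ : Fin d => Finset.Icc (-(R : ℤ)) (R : ℤ)), c v ≤ C) (q : Site d) :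
    ∑ h ∈ Finset.range H, ∑ v ∈ (Fintype.piFinset (fun _ : Fin d => Finset.Icc (-(R : ℤ)) (R : ℤ))).filter
        (fun v => (∀ ν ∈ D, (q - (h : ℤ) • e ι) ν = v ν) ∧ (∀ ν, ν ∉ D → ν ≠ κ → (q - (h : ℤ) • e ι) ν = 0)
          ∧ v κ < (q - (h : ℤ) • e ι) κ ∧ (q - (h : ℤ) • e ι) κ ≤ 0), c v
      ≤ (H : ℝ) * (C * ((R * (2 * R + 1) ^ (d - (D.card + 1)) : ℕ) : ℝ)) := by
  calc _ ≤ ∑ h ∈ Finset.range H, C * ((R * (2 * R + 1) ^ (d - (D.card + 1)) : ℕ) : ℝ) :=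
        Finset.sum_le_sum fun h _ => weight_neg_le_unif R D κ hκ c C hC hc (q - (h : ℤ) • e ι)
    _ = _ := by rw [Finset.sum_const, Finset.card_range, nsmul_eq_mul]

/-! ## §3 The comb reading: later comb directions are free coordinates of the earlier runs -/

/-- ★★ **OFFSET SUM ALONG A LATER COMB DIRECTION — NO FACTOR `H` (forward)**: for the split `(finRange d).reverse = s ++ μ :: t`, run `i < |t|` and an offset direction `ι ∈ t.drop (i+1)`
(so `ι ∉ D_i`, `ι ≠ t[i]` by ✓ `not_mem_foldl_insert_iff`), with `D_i = (t.take i).foldl insert (insert μ s.toFinset)`: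
`Σ_(h<H) W⁺_(D_i,t[i])(q − h•e_ι) ≤ C·(R − q (t[i]))⁺·(2R+1)^(|t|−1−i)`. [cite: Balaban1985UV3, (27) p.263] [cite: Balaban1985Averaging, (8)–(9) pp.18–19, p.24] -/
theorem sum_offsets_combWeight_pos_le (R H : ℕ) (μ : Fin d) {s t : List (Fin d)} (hsp : (List.finRange d).reverse = s ++ μ :: t) (i : ℕ) (hi : i < t.length)
    (ι : Fin d) (hι : ι ∈ t.drop (i + 1)) (c : Site d → ℝ) (C : ℝ) (hC : 0 ≤ C)
    (hc : ∀ v ∈ Fintype.piFinset (fun _ : Fin d => Finset.Icc (-(R : ℤ)) (R : ℤ)), c v ≤ C) (q : Site d) :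
    ∑ h ∈ Finset.range H, ∑ v ∈ (Fintype.piFinset (fun _ : Fin d => Finset.Icc (-(R : ℤ)) (R : ℤ))).filter
        (fun v => (∀ ν ∈ (t.take i).foldl (fun S ν => insert ν S) (insert μ s.toFinset), (q - (h : ℤ) • e ι) ν = v ν)
          ∧ (∀ ν, ν ∉ (t.take i).foldl (fun S ν => insert ν S) (insert μ s.toFinset) → ν ≠ t.getD i μ → (q - (h : ℤ) • e ι) ν = 0)
          ∧ 0 ≤ (q - (h : ℤ) • e ι) (t.getD i μ) ∧ (q - (h : ℤ) • e ι) (t.getD i μ) < v (t.getD i μ)), c v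
      ≤ C * ((((R : ℤ) - q (t.getD i μ)).toNat * (2 * R + 1) ^ (t.length - 1 - i) : ℕ) : ℝ) := by
  classical
  obtain ⟨hs, ht, hμs, hμt, hts, hlen⟩ := split_nodup μ hsp
  obtain ⟨hιD, hικ⟩ := (not_mem_foldl_insert_iff μ hsp i hi ι).mpr hι
  have hκD : t.getD i μ ∉ (t.take i).foldl (fun S ν => insert ν S) (insert μ s.toFinset) := by
    have hmem : t.getD i μ ∈ t.drop i := by
      rw [List.getD_eq_getElem _ _ hi, List.drop_eq_getElem_cons hi]; exact List.mem_cons_self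
    have h' := (not_mem_foldl_insert_iff μ hsp i hi (t.getD i μ))
    -- direct: membership would contradict `t.Nodup`
    rw [mem_foldl_insert, Finset.mem_insert, List.mem_toFinset]
    rintro ((h1 | h1) | h1)
    · exact hμt (h1 ▸ List.mem_of_mem_drop hmem)
    · exact hts _ (List.mem_of_mem_drop hmem) h1
    · have hnd : (t.take i ++ t.drop i).Nodup := by rwa [List.take_append_drop]
      exact (List.nodup_append.mp hnd).2.2 _ h1 _ hmem rfl
  have hcard : ((t.take i).foldl (fun S ν => insert ν S) (insert μ s.toFinset)).card = s.length + 1 + i := by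
    have hD' : ∀ κ ∈ t.take i, κ ∉ insert μ s.toFinset := by
      intro κ hκ hmem
      have hκt : κ ∈ t := List.mem_of_mem_take hκ
      rcases Finset.mem_insert.mp hmem with h1 | h1
      · exact hμt (h1 ▸ hκt)
      · exact hts κ hκt (List.mem_toFinset.mp h1)
    rw [card_foldl_insert (t.take i) (insert μ s.toFinset) (ht.sublist (List.take_sublist i t)) hD',
      Finset.card_insert_of_notMem (fun h' => hμs (List.mem_toFinset.mp h')), List.toFinset_card_of_nodup hs, List.length_take,
      Nat.min_eq_left hi.le]
  have main := sum_offsets_weight_pos_le R H ((t.take i).foldl (fun S ν => insert ν S) (insert μ s.toFinset)) (t.getD i μ) ι hκD hιD hικ c C hC hc q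
  rw [hcard, show d - (s.length + 1 + i + 1) = t.length - 1 - i by omega] at main
  exact main

/-- ★★ **OFFSET SUM ALONG A LATER COMB DIRECTION — NO FACTOR `H` (backward)**: `Σ_(h<H) W⁻_(D_i,t[i])(q − h•e_ι) ≤ C·(R + q (t[i]))⁺·(2R+1)^(|t|−1−i)` for `ι ∈ t.drop (i+1)`.
[cite: Balaban1985UV3, (27) p.263] [cite: Balaban1985Averaging, (8)–(9) pp.18–19, p.24] -/
theorem sum_offsets_combWeight_neg_le (R H : ℕ) (μ : Fin d) {s t : List (Fin d)} (hsp : (List.finRange d).reverse = s ++ μ :: t) (i : ℕ) (hi : i < t.length)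
    (ι : Fin d) (hι : ι ∈ t.drop (i + 1)) (c : Site d → ℝ) (C : ℝ) (hC : 0 ≤ C)
    (hc : ∀ v ∈ Fintype.piFinset (fun _ : Fin d => Finset.Icc (-(R : ℤ)) (R : ℤ)), c v ≤ C) (q : Site d) :
    ∑ h ∈ Finset.range H, ∑ v ∈ (Fintype.piFinset (fun _ : Fin d => Finset.Icc (-(R : ℤ)) (R : ℤ))).filter
        (fun v => (∀ ν ∈ (t.take i).foldl (fun S ν => insert ν S) (insert μ s.toFinset), (q - (h : ℤ) • e ι) ν = v ν)
          ∧ (∀ ν, ν ∉ (t.take i).foldl (fun S ν => insert ν S) (insert μ s.toFinset) → ν ≠ t.getD i μ → (q - (h : ℤ) • e ι) ν = 0)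
          ∧ v (t.getD i μ) < (q - (h : ℤ) • e ι) (t.getD i μ) ∧ (q - (h : ℤ) • e ι) (t.getD i μ) ≤ 0), c v
      ≤ C * ((((R : ℤ) + q (t.getD i μ)).toNat * (2 * R + 1) ^ (t.length - 1 - i) : ℕ) : ℝ) := by
  classical
  obtain ⟨hs, ht, hμs, hμt, hts, hlen⟩ := split_nodup μ hsp
  obtain ⟨hιD, hικ⟩ := (not_mem_foldl_insert_iff μ hsp i hi ι).mpr hι
  have hκD : t.getD i μ ∉ (t.take i).foldl (fun S ν => insert ν S) (insert μ s.toFinset) := by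
    have hmem : t.getD i μ ∈ t.drop i := by
      rw [List.getD_eq_getElem _ _ hi, List.drop_eq_getElem_cons hi]; exact List.mem_cons_self
    rw [mem_foldl_insert, Finset.mem_insert, List.mem_toFinset]
    rintro ((h1 | h1) | h1)
    · exact hμt (h1 ▸ List.mem_of_mem_drop hmem)
    · exact hts _ (List.mem_of_mem_drop hmem) h1
    · have hnd : (t.take i ++ t.drop i).Nodup := by rwa [List.take_append_drop]
      exact (List.nodup_append.mp hnd).2.2 _ h1 _ hmem rfl
  have hcard : ((t.take i).foldl (fun S ν => insert ν S) (insert μ s.toFinset)).card = s.length + 1 + i := by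
    have hD' : ∀ κ ∈ t.take i, κ ∉ insert μ s.toFinset := by
      intro κ hκ hmem
      have hκt : κ ∈ t := List.mem_of_mem_take hκ
      rcases Finset.mem_insert.mp hmem with h1 | h1
      · exact hμt (h1 ▸ hκt)
      · exact hts κ hκt (List.mem_toFinset.mp h1)
    rw [card_foldl_insert (t.take i) (insert μ s.toFinset) (ht.sublist (List.take_sublist i t)) hD',
      Finset.card_insert_of_notMem (fun h' => hμs (List.mem_toFinset.mp h')), List.toFinset_card_of_nodup hs, List.length_take,
      Nat.min_eq_left hi.le]
  have main := sum_offsets_weight_neg_le R H ((t.take i).foldl (fun S ν => insert ν S) (insert μ s.toFinset)) (t.getD i μ) ι hκD hιD hικ c C hC hc q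
  rw [hcard, show d - (s.length + 1 + i + 1) = t.length - 1 - i by omega] at main
  exact main

end Summit.QuantumFields.YangMills.Theorems.Prop7CombLadderCountExactOffsets
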